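import Summits.BirchSwinnertonDyer.BirchSwinnertonDyer.Theses.PrintX6
import Summits.BirchSwinnertonDyer.Rank1Residual.X4.KuriharaLowerHalf
import Summits.BirchSwinnertonDyer.Rank1Residual.X4.KimTamagawaDefect
import Literature.NumberTheory.EllipticCurves.Rank1Residual.Typed.X6
import HarnessLib

/-!
# Line `kim-deficit` on crux `PrintX6.EisensteinHalfFiveLeRest` (stmt-BirchSwinnertonDyer-21116) — STUB 2
# `stub_missingLowerBoundAt_of_levelCertificate_X6` (the ENGINE), BY NAME modulo its published inputs

Route `PrintX6`, crux `EisensteinHalfFiveLeRest` (rank 211), registered line `kim_deficit`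
(`Cruxes/EisensteinHalfFiveLeRest/Lines/kim_deficit.lean`, sha16 `35e5095fac56ab01`, bsd-idea-8 g2;
director-bsd ROW 6 RULING (154)(b): stubs 1–2 only, stub 3 = Kato IMC for the class is NOT attacked).

STUB 2 as registered — on X6 ∧ `p ≥ 5` ∧ `r_an = 0`, "every newform `f` of `W` carries a Kurihara
certificate of level `k ≤ ord_p ∏ c_ℓ + 1`" ⟹ `Typed.MissingLowerBoundAt W p` — carries NO fact
hypothesis, yet its content is C.-H. Kim's structure theorem (Amer. J. Math. 148 (2026) Thm. 1.8 (6))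
plus Gross–Zagier–Kolyvagin, modularity and the Néron/newform period comparison, all of which live in
the tree as UNPROVED NAMED FACTS. As typed it therefore closes only when those facts are discharged.
This file lands the honest BY-NAME form (the line card's own reading "closable modulo NAMED REFEREED
facts only (conditional-result)"):

  `PublishedInputsX6` (the route's nine-fact input pack, item stmt-20302: conjunct 4 = period transfer
  `realPeriodRat_eq_unit_mul_plusPeriod`, conjunct 8 = `hasEntireLFunction_rat`, conjunct 9 = GZK)
  → `Kim2026.rankZero_le_padicValNat_sha_of_kuriharaNumber_ne_zero` (Kim 2026 Thm. 1.8 (6), level `p^k`)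
  → (MANIN SUPPLY, displayed: at a good `p ≥ 5` with `E[p]` irreducible, `W` admits a modular
     parametrisation datum at level `N_E` with Manin constant prime to `p` — Mazur 1978 Cor. 4.1 for the
     strong curve composed with an isogeny of degree prime to `p`; NOT a conjunct of the pack, which only
     supplies SOME datum, `nonempty_modularParametrizationData`, and NOT derivable from it)
  → ⟨the registered signature of stub 2, verbatim⟩,

through the tree theorem `X4.missingLowerBoundAt_rankZero_of_kimLower` (class-agnostic despite its
namespace; `ρ̄` onto is `ClassX6.surj`, `L(E,1) ≠ 0` is `r_an = 0` by `analyticRank_eq_zero_iff_holds`).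
For the LEAD / planner: the corrected stub signature is exactly the statement of
`stub_missingLowerBoundAt_of_levelCertificate_X6_of_facts` below (three displayed binders, then the
registered text); the composition `EisensteinHalfFiveLeRest_of` reshaped accordingly is
`eisensteinHalfFiveLeRest_of_kimDeficit_of_facts` (crux ⟸ pack ∧ Kim 1.8 (6) ∧ Manin supply ∧ STUB 3).

HONEST FRAMING: a CONDITIONAL by-name composition; every arithmetic input is a displayed hypothesis;
the hard stub 3 (`∂^{(∞)}(δ̃) ≤ ord_p ∏ c_ℓ` on X6-Rest ∧ `r_an = 0`, ⟺ Kato's IMC for the class) is a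
HYPOTHESIS here and is not attacked; the crux stays OPEN; BSD is not proved by any of this. Lands
`--supports stmt-BirchSwinnertonDyer-21116` (line kim-deficit, stub 2 by name).
-/

set_option autoImplicit false
-- single-conjunct summit: the canonical namespace `Summit.BirchSwinnertonDyer.BirchSwinnertonDyer.…` repeats the name
set_option linter.dupNamespace false

noncomputable section

open scoped Classical MatrixGroups ModularForm

open CongruenceSubgroup WeierstrassCurve Literature.NumberTheory.EllipticCurves
  Literature.NumberTheory.EllipticCurves.ModularForms
  Literature.NumberTheory.EllipticCurves.Rank1Residual
  Literature.NumberTheory.EllipticCurves.Rank1Residual.Typed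
  Summit.BirchSwinnertonDyer.Rank1Residual
  Summit.BirchSwinnertonDyer.Rank1Residual.Supersingular
  Summit.BirchSwinnertonDyer.BirchSwinnertonDyer.Theses.PrintX6

namespace Summit.BirchSwinnertonDyer.BirchSwinnertonDyer.Theorems.PrintX6.KimDeficit

/-- **STUB 2 of line `kim-deficit`, BY NAME** (the engine). Displayed inputs: the route pack
`PublishedInputsX6` (period transfer `Ω(W) = u·Ω⁺_f`, `|u|_p = 1` at a good `p ≥ 5` with `E[p]`
irreducible; modularity `hasEntireLFunction_rat`; GZK), Kim 2026 Thm. 1.8 (6) at level `p^k`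
(`Kim2026.rankZero_le_padicValNat_sha_of_kuriharaNumber_ne_zero`), and the MANIN SUPPLY (a
parametrisation datum at level `N_E` with `p ∤ c`). Conclusion: the registered signature of
`stub_missingLowerBoundAt_of_levelCertificate_X6` VERBATIM — on X6 ∧ `p ≥ 5` ∧ `r_an = 0`, a Kurihara
certificate of level `k ≤ ord_p ∏ c_ℓ + 1` for every newform of `W` gives the LOWER half
`ord_p #Ш_an ≤ ord_p #Ш` (`Typed.MissingLowerBoundAt W p`). Proof: take the datum `D` of the Manin
supply (`ρ̄` irreducible by `ClassX6.irr`, good reduction from `ClassX6`), its newform `D.f`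
(`D.isNewformOf`), the period transfer for `D.f` from conjunct 4, surjectivity from `ClassX6.surj`,
`L(E,1) ≠ 0` from `r_an = 0`, the certificate at `D.f`, and `X4.missingLowerBoundAt_rankZero_of_kimLower`.
CONDITIONAL; per the line card "closable modulo named refereed facts only".
[cite: Kim2022StructureSelmer, Thm. 1.9 (6) (PDF p. 8) and §1.5.1–1.5.3 (PDF pp. 7–8)]
[cite: GreenbergVatsal2000, Remark 3.4] [cite: Mazur1978, Cor. 4.1] [cite: Miller2011LMS, Def. 1.1] -/
theorem stub_missingLowerBoundAt_of_levelCertificate_X6_of_facts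
    (hPub : PublishedInputsX6)
    (hKimk : Kim2026.rankZero_le_padicValNat_sha_of_kuriharaNumber_ne_zero)
    (hManin : ∀ (W : WeierstrassCurve ℚ) [W.IsElliptic] [W.IsGloballyMinimal] (p : ℕ) [Fact p.Prime],
      5 ≤ p → W.HasGoodReductionAtPrime p → W.HasIrreducibleModPGaloisRep p →
      ∀ [NeZero (W.conductorNorm ℤ)],
        ∃ D : ModularParametrizationData W (W.conductorNorm ℤ), ¬ (p : ℤ) ∣ D.maninConstant) :
    ∀ (W : WeierstrassCurve ℚ) [W.IsElliptic] [W.IsGloballyMinimal] (p : ℕ) [Fact p.Prime],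
      5 ≤ p → ClassX6 W p → W.analyticRank = 0 →
      (∀ [NeZero (W.conductorNorm ℤ)] (f : CuspForm (Gamma0 (W.conductorNorm ℤ)) 2), IsNewformOf W f →
        ∃ (k n : ℕ) (_ : NeZero n), 1 ≤ k ∧ k ≤ padicValNat p W.tamagawaProduct + 1 ∧
          Kato.IsKolyvaginProduct W p k n ∧
          (∀ (ℓ : ℕ) [Fact ℓ.Prime], ℓ ∣ n →
            Nat.card {P : ((WeierstrassCurve.integralModelInt W).map
                (Int.castRingHom (ZMod ℓ))).toAffine.Point // p • P = 0} ≤ p) ∧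
          ∃ ψ : (ℓ : ℕ) → (ZMod ℓ)ˣ →* Multiplicative (ZMod (p ^ k)),
            (∀ ℓ ∈ n.primeFactors, Function.Surjective (ψ ℓ)) ∧
              kuriharaNumber f (p ^ k) n ψ ≠ 0) →
      MissingLowerBoundAt W p := by
  intro W _ _ p _ hp5 hX hr0 hcert
  obtain ⟨-, -, -, hϖ, -, -, -, hmod, hGZK⟩ := hPub
  have hp2 : p ≠ 2 := by omega
  have hirr : Irr W p := ClassX6.irr W p hp2 hX
  have hsurj : Surj W p := ClassX6.surj W p hp2 hX
  have hL : W.entireLFunction 1 ≠ 0 := (W.analyticRank_eq_zero_iff_holds (hmod W)).1 hr0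
  haveI : NeZero (W.conductorNorm ℤ) := ⟨(W.conductorNorm_pos_holds).ne'⟩
  obtain ⟨D, hc⟩ := hManin W p hp5 hX.1.1 hirr
  have hper : ∃ u : ℚ, ‖(u : ℚ_[p])‖ = 1 ∧ W.realPeriodRat = u * plusPeriod D.f :=
    hϖ W p hp5 hX.1.1 hirr D.f D.isNewformOf
  obtain ⟨k, n, hn0, hk1, hkt, hk, hcyc, ψ, hψ, hne⟩ := hcert D.f D.isNewformOf
  haveI : NeZero n := hn0
  exact X4.missingLowerBoundAt_rankZero_of_kimLower W p hKimk hGZK hp5 hsurj hL D hc hper k n hk1 hkt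
    hk (fun ℓ _ hℓ => hcyc ℓ hℓ) ψ hψ hne

/-- **The line's composition, reshaped BY NAME: crux ⟸ pack ∧ Kim 1.8 (6) ∧ Manin supply ∧ STUB 3.**
With stub 1 a tree theorem (`X4.exists_certificate_of_kuriharaPartialInfty_le`) and stub 2 the
by-name engine above, the crux `PrintX6.EisensteinHalfFiveLeRest` follows from the three displayed
inputs and the HARD stub 3 `stub_partialInfty_le_tamagawa_X6Rest` (taken here as the HYPOTHESIS
`h₃`, verbatim; ⟺ the `≤` half of Kim's Conjecture 1.10 on X6-Rest ∧ `r_an = 0`, NOT attacked). The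
rational value of `#Ш_an` is identified with the crux's `q` by injectivity of `ℚ → ℂ`, as in the
registered `EisensteinHalfFiveLeRest_of`. CONDITIONAL; closes nothing; the crux stays open.
[cite: Kim2022StructureSelmer, Thm. 1.9 (6) and Conj. 1.10 (PDF p. 8)] [cite: Miller2011LMS, Def. 1.1] -/
theorem eisensteinHalfFiveLeRest_of_kimDeficit_of_facts
    (hPub : PublishedInputsX6)
    (hKimk : Kim2026.rankZero_le_padicValNat_sha_of_kuriharaNumber_ne_zero)
    (hManin : ∀ (W : WeierstrassCurve ℚ) [W.IsElliptic] [W.IsGloballyMinimal] (p : ℕ) [Fact p.Prime],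
      5 ≤ p → W.HasGoodReductionAtPrime p → W.HasIrreducibleModPGaloisRep p →
      ∀ [NeZero (W.conductorNorm ℤ)],
        ∃ D : ModularParametrizationData W (W.conductorNorm ℤ), ¬ (p : ℤ) ∣ D.maninConstant)
    (h₃ : ∀ (W : WeierstrassCurve ℚ) [W.IsElliptic] [W.IsGloballyMinimal] (p : ℕ) [Fact p.Prime],
      ¬ W.HasCM → 5 ≤ p → ClassX6 W p → W.analyticRank = 0 → ¬ HasErratumPrime W p →
      ∀ [NeZero (W.conductorNorm ℤ)] (f : CuspForm (Gamma0 (W.conductorNorm ℤ)) 2), IsNewformOf W f →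
        kuriharaPartialInfty W p f ≤ (padicValNat p W.tamagawaProduct : ℕ∞)) :
    Summit.BirchSwinnertonDyer.BirchSwinnertonDyer.Theses.PrintX6.EisensteinHalfFiveLeRest := by
  intro W _ _ p _ hCM hp5 hX hr0 hRest q hq _hvq
  have hlow : MissingLowerBoundAt W p := by
    refine stub_missingLowerBoundAt_of_levelCertificate_X6_of_facts hPub hKimk hManin W p hp5 hX hr0 ?_
    intro _ f hf
    obtain ⟨n, k, hk, hcyc, hk1, hkt, ψ, hψ, hne⟩ :=
      X4.exists_certificate_of_kuriharaPartialInfty_le W p f (h₃ W p hCM hp5 hX hr0 hRest f hf)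
    exact ⟨k, n, ⟨hk.ne_zero⟩, hk1, hkt, hk, fun ℓ _ hℓ => hcyc.2 ℓ hℓ, ψ, hψ, hne⟩
  obtain ⟨q', hq', hle⟩ := hlow
  have hqq : q = q' := by exact_mod_cast hq.symm.trans hq'
  subst hqq
  exact hle

end Summit.BirchSwinnertonDyer.BirchSwinnertonDyer.Theorems.PrintX6.KimDeficit

end
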